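import Summits.Ventures.QEC.Census.BB.BB288.CoverLevel2A2d
import HarnessLib

set_option Elab.async false
set_option maxRecDepth 100000
set_option exponentiation.threshold 512

/-!
# `[[288,12,18]]` cover certificate — LEVEL 2 replays: matrix 2, 2 families (m2p12345, m2p012345…)
(type-01 lane engine `Plane.segOK` / qec-search-5 `Plane.topOK`, each family against its own straggler list, lifted to
`FOUND₂` by type-10 `CertBZPlaneAllow`; see `CoverLevel2Defs`.)  Decided data checks; tier KERNEL, axioms standard.
-/

namespace Summit.Ventures.QEC.Census.BB288Cover

open Summit.Ventures.QEC.Census Literature.InformationTheory.QuantumCodes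

/-- The stragglers of family `m2p12345` are listed in `FOUND₂` (one merge walk). -/
theorem m2p12345_sub : Plane.subWalk m2p12345_allow found2 = true := by decide +kernel

/-- Replay of family `m2p12345` (top rows `[25, 26, 27, 28, 29]` fixed, `≤ 2` rows below `24`; 301 lanes) against its own list. -/
theorem m2p12345_own : Plane.topOK 72 16 m2p12345_allow (giRows Gb2 l2m2) 24 2 6 [25, 26, 27, 28, 29] 800 = true := by
  set_option maxHeartbeats 400000000 in decide +kernel

/-- … hence against `FOUND₂`. -/
theorem m2p12345 : Plane.topOK 72 16 found2 (giRows Gb2 l2m2) 24 2 6 [25, 26, 27, 28, 29] 800 = true :=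
  Plane.topOK_mono_allow (Plane.mem_of_subWalk _ _ m2p12345_sub) m2p12345_own

/-- The stragglers of family `m2p012345` are listed in `FOUND₂` (one merge walk). -/
theorem m2p012345_sub : Plane.subWalk m2p012345_allow found2 = true := by decide +kernel

/-- Replay of family `m2p012345` (top rows `[24, 25, 26, 27, 28, 29]` fixed, `≤ 1` rows below `24`; 25 lanes) against its own list. -/
theorem m2p012345_own : Plane.topOK 72 16 m2p012345_allow (giRows Gb2 l2m2) 24 1 6 [24, 25, 26, 27, 28, 29] 800 = true := by
  set_option maxHeartbeats 400000000 in decide +kernel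

/-- … hence against `FOUND₂`. -/
theorem m2p012345 : Plane.topOK 72 16 found2 (giRows Gb2 l2m2) 24 1 6 [24, 25, 26, 27, 28, 29] 800 = true :=
  Plane.topOK_mono_allow (Plane.mem_of_subWalk _ _ m2p012345_sub) m2p012345_own


end Summit.Ventures.QEC.Census.BB288Cover
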